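import Summits.QuantumFields.YangMills.Theorems.FluctuationComparisonRegPrIntLS2BetaKPLCriterion
import Literature.MathematicalPhysics.QuantumFieldTheory.Sweep1AreaLawProofs
import HarnessLib

/-!
# (R3-A) · AGGREGATION BY FOOTPRINT — Bałaban's (1.90)∕(1.91) «for the fixed decomposition we resum all the expressions determining the same components»
# as a generic finite identity: history-indexed, component-factorised sums ARE the hard-core (`polyInc`) gas of the footprint-aggregated activities

Cell `ym3-torus` (HUMAN RULING D-0037: rung R3 = continuum `SU(2)` Yang–Mills on `T³` — NOT `d = 4`, NOT infinite volume, NOT a mass gap, NOT the Clay problem);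
seat `ymfull-r3-prover-1` (gen 0; director-ym R600-ym ∕ ★★OWNER ym3-torus RULING №57 (B): hand = the registered stub `stub_largeFieldFourPtIntCan`, registry
`Cruxes/FluctuationComparisonRegPrIntL/Lines/semiclassical_s2beta.lean` v11.4, plan document `Lines/largefield_gas.lean` v3); helper of the crux `stmt-QuantumFields-20520`
`UnitScaleTilt.FluctuationComparisonRegPrIntL` (`--supports … --as helper`, NOT a proof of it); FILE 2 of this seat's LOCATE-R (20520 evidence #56; FILE 1 =
`…LargeFieldGasEntropyCriterion`, (R3-E)).  THEOREMS ONLY: 0 `def`, 0 `instance`, 0 `notation`, 0 `sorry`, default heartbeats.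

WHERE THIS SITS.  The interior gas identity LFG^{can}∘ (px10 g16's door `…LargeFieldGasInteriorDoor`) wants the ratio «full ∕ small-history» canonical densities written as
`Re Ξ_{polyInc}(w_U)` — ONE activity per bond polymer `X`.  What the 𝐑-operation's expansion with holes produces ((R1∘-gas) of LOCATE-R §1) is, per deep HISTORY `Q`
(a finite set of large-plaquette labels), a sum over COMPATIBLE FAMILIES `𝒳` of connected footprints decomposing `Q`, of PRODUCTS of component activities `ζ(Q↾X, X)`
depending only on the sub-history `Q↾X` inside the component.  Print then says ((1.91) p.388): the activity of a footprint `X′` is the sum «over {X_{j1},…,X_{jq}} and D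
such that the connected localization domain they determine is equal to X′» — i.e. `w(X) := Σ_{Q′ admissible for X} ζ(Q′, X)` — and (1.90) `{…} = 1 + Σ_r Σ_{X′₁…X′_r} Π F(X′_p)`.
This file is that regrouping as a kernel identity, generic and gauge-free (any finite bond type `B`, label type `Λ`, locator `π : Λ → B`, admissibility `Adm`, activities `ζ`
— all binders; the restriction `Q↾X` is spelled `Q.filter (π · ∈ X)`):

* §1 `prod_sum_eq_sum_dec_prod` ★★ — FOR ONE PAIRWISE-DISJOINT FAMILY `𝒳`: `Π_{X ∈ 𝒳} Σ_{Adm Q′ X} ζ Q′ X = Σ_{Q ∈ Dec 𝒳} Π_{X ∈ 𝒳} ζ (Q↾X) X`, where `Dec 𝒳` = the histories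
  located inside `⋃ 𝒳` whose every restriction is admissible (induction on `𝒳`; the bijection `(Q′, Q) ↦ Q′ ∪ Q`, inverse `Q″ ↦ (Q″↾X₀, Q″ off X₀)`, by disjointness).
* §2 `re_polymerPartitionFunction_ofReal` — for REAL activities `Re Ξ_{polyInc}(w) = Σ_{𝒳 compatible} Π_{X∈𝒳} w X`; `disjoint_of_isCompatible` — compatible = pairwise disjoint.
* §3 ★★ `sum_compatible_sum_dec_eq_re_gasZ` — (1.90): `Σ_{𝒳 compatible} Σ_{Q ∈ Dec 𝒳} Π ζ(Q↾X) X = Re Ξ_{polyInc}(w)`, `w X := Σ_{Adm Q′ X} ζ Q′ X`; and the HISTORY-MAJOR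
  reading ★ `sum_hist_sum_dec_eq_re_gasZ` — `Σ_Q Σ_{𝒳 compatible, Q ∈ Dec 𝒳} Π ζ(Q↾X) X = Re Ξ(w)` (the shape (R1∘-gas) delivers, summed over histories);
  ★ `sum_ratios_eq_re_gasZ` — the socket form: per-history ratios `r Q` equal to their factorised expansions ⇒ `Σ_Q r Q = Re Ξ(w)`.
* §4 the letters the aggregate inherits (what `KPGasOn`∕FILE 1 ask of `w`): `aggregate_local` (V-locality in `X` from that of every `ζ(Q′, X, ·)`), `abs_aggregate_le`
  (`|w U X| ≤ w̄ X := Σ_{Adm Q′ X} ζ̄ Q′ X`), `aggregate_empty` (`w U ∅ = 0` when nothing is admissible for `∅`), and the ENERGY TRANSFER ★ `aggregate_majorant_le`: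
  if `Adm Q′ X ⇒ Q′ ≠ ∅ ∧ π(Q′) ⊆ X` and `ζ̄ Q′ X ≤ (Π_{l∈Q′} sf l)·E X` (per-plaquette small factors (67)–(71) × a footprint decay), then
  `w̄ X ≤ (e^{Σ_{π l ∈ X} sf l} − 1)·E X ≤ (Σ_{π l ∈ X} sf l)·e^{Σ_{π l ∈ X} sf l}·E X` (`Π(1 + sf) − 1`, `1 + x ≤ eˣ`, lit ✓`AreaLaw.exp_sub_one_le_mul_exp` `eʸ − 1 ≤ y eʸ`) — the `δ·e^{−μ·size}` input of FILE 1.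

HONEST — WHAT THIS IS NOT.  Finite combinatorics (a product of sums, one bijection, `Π(1+x) = Σ Π x`); it discharges the (R3) REGROUPING arrow of «(R1) expansion with holes →
(R2) small factors → (R3) resummation + KP» and nothing before it: the factorised expansion itself ((R1∘-gas): [Balaban1985UV3] (43)–(47); [Balaban1989LargeFieldII]
(1.29)–(1.97)) is NOT touched; LFG^{can}∘ ∕ `stub_largeFieldFourPtIntCan` ∕ S2β ∕ the crux 20520 NOT proved; `YM3TorusSU2` NOT proved; finite volume ∕ conditional; the
Yang–Mills mass gap (Clay) NOT proved; rung R3 = YM₃ on `T³` — NOT `d = 4`, NOT infinite volume, NOT a mass gap.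
References: [Balaban1989LargeFieldII] T. Bałaban, CMP 122 (1989): (1.90)–(1.91) p.388, (1.97) p.389; [Balaban1985UV3] CMP 102 (1985): (41) p.266, (67)–(71) pp.273–274;
[KoteckyPreiss1986] CMP 103 (1986), Theorem p.492; [FernandezProcacci2007] R. Fernández, A. Procacci, CMP 274 (2007) §2 (hard-core polymer gas).
-/

set_option autoImplicit false

noncomputable section

open Finset
open scoped BigOperators
open Literature.Probability.LatticeModels

namespace Summit.QuantumFields.YangMills.Theorems.FluctuationComparisonRegPrIntLLargeFieldGasAggregation

variable {B : Type*} [Fintype B] [DecidableEq B] {Λ : Type*} [Fintype Λ] [DecidableEq Λ]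

/-! ## §1 One pairwise-disjoint family: the product of aggregated activities is the sum over decomposed histories -/

section OneFamily

variable (π : Λ → B) (Adm : Finset Λ → Finset B → Prop) (ζ : Finset Λ → Finset B → ℝ)

omit [Fintype B] [Fintype Λ] in
/-- Restricting a union located off `X₀` ∪ inside `X₀`: `(Q′ ∪ Q)↾X₀ = Q′` when `π(Q′) ⊆ X₀` and `π(Q) ∩ X₀ = ∅`. [cite: Balaban1989LargeFieldII, (1.91) p.388 (bookkeeping)] -/
theorem filter_union_eq_left {X₀ : Finset B} {Q' Q : Finset Λ} (hQ' : ∀ l ∈ Q', π l ∈ X₀) (hQ : ∀ l ∈ Q, π l ∉ X₀) :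
    (Q' ∪ Q).filter (fun l => π l ∈ X₀) = Q' := by
  ext l
  simp only [Finset.mem_filter, Finset.mem_union]
  constructor
  · rintro ⟨hl | hl, hπ⟩
    · exact hl
    · exact absurd hπ (hQ l hl)
  · exact fun hl => ⟨Or.inl hl, hQ' l hl⟩

omit [Fintype B] [Fintype Λ] in
/-- `(Q′ ∪ Q)↾X = Q↾X` when `π(Q′)` misses `X`. [cite: Balaban1989LargeFieldII, (1.91) p.388 (bookkeeping)] -/
theorem filter_union_eq_right {X : Finset B} {Q' Q : Finset Λ} (hQ' : ∀ l ∈ Q', π l ∉ X) :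
    (Q' ∪ Q).filter (fun l => π l ∈ X) = Q.filter (fun l => π l ∈ X) := by
  ext l
  simp only [Finset.mem_filter, Finset.mem_union]
  constructor
  · rintro ⟨hl | hl, hπ⟩
    · exact absurd hπ (hQ' l hl)
    · exact ⟨hl, hπ⟩
  · exact fun h => ⟨Or.inr h.1, h.2⟩

open Classical in
/-- ★★ **ONE DISJOINT FAMILY**: for a pairwise-disjoint family `𝒳` of bond polymers, admissibility `Adm Q′ X` forcing `π(Q′) ⊆ X`, and any component activities `ζ`,
`Π_{X ∈ 𝒳} Σ_{Q′ : Adm Q′ X} ζ Q′ X = Σ_{Q ∈ Dec 𝒳} Π_{X ∈ 𝒳} ζ (Q↾X) X`, where `Dec 𝒳 = {Q | π(Q) ⊆ ⋃𝒳 ∧ ∀ X ∈ 𝒳, Adm (Q↾X) X}` and `Q↾X = Q.filter (π · ∈ X)` — the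
regrouping of (1.90)∕(1.91) for a fixed family of components. [cite: Balaban1989LargeFieldII, (1.90)-(1.91) p.388] -/
theorem prod_sum_eq_sum_dec_prod (hAdm : ∀ Q' X, Adm Q' X → ∀ l ∈ Q', π l ∈ X) (𝒳 : Finset (Finset B))
    (hdisj : ∀ X ∈ 𝒳, ∀ Y ∈ 𝒳, X ≠ Y → Disjoint X Y) :
    ∏ X ∈ 𝒳, ∑ Q' ∈ Finset.univ.filter (fun Q' : Finset Λ => Adm Q' X), ζ Q' X =
      ∑ Q ∈ Finset.univ.filter (fun Q : Finset Λ => (∀ l ∈ Q, ∃ X ∈ 𝒳, π l ∈ X) ∧ ∀ X ∈ 𝒳, Adm (Q.filter fun l => π l ∈ X) X),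
        ∏ X ∈ 𝒳, ζ (Q.filter fun l => π l ∈ X) X := by
  induction 𝒳 using Finset.induction_on with
  | empty =>
    have hset : Finset.univ.filter (fun Q : Finset Λ => (∀ l ∈ Q, ∃ X ∈ (∅ : Finset (Finset B)), π l ∈ X) ∧
        ∀ X ∈ (∅ : Finset (Finset B)), Adm (Q.filter fun l => π l ∈ X) X) = {∅} := by
      ext Q
      simp only [Finset.mem_filter, Finset.mem_univ, true_and, Finset.notMem_empty, IsEmpty.forall_iff, implies_true, and_true,
        false_and, exists_false, Finset.mem_singleton]
      exact ⟨fun h => Finset.eq_empty_of_forall_notMem (fun l hl => h l hl), fun h => by subst h; simp⟩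
    rw [hset, Finset.sum_singleton, Finset.prod_empty, Finset.prod_empty]
  | insert X₀ 𝒳 hX₀ ih =>
    -- disjointness data
    have hdisj𝒳 : ∀ X ∈ 𝒳, ∀ Y ∈ 𝒳, X ≠ Y → Disjoint X Y := fun X hX Y hY hne =>
      hdisj X (Finset.mem_insert_of_mem hX) Y (Finset.mem_insert_of_mem hY) hne
    have hd₀ : ∀ X ∈ 𝒳, Disjoint X₀ X := fun X hX =>
      hdisj X₀ (Finset.mem_insert_self _ _) X (Finset.mem_insert_of_mem hX) (fun h => hX₀ (h ▸ hX))
    -- abbreviations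
    set S₀ : Finset (Finset Λ) := Finset.univ.filter (fun Q' : Finset Λ => Adm Q' X₀) with hS₀
    set D : Finset (Finset Λ) := Finset.univ.filter (fun Q : Finset Λ => (∀ l ∈ Q, ∃ X ∈ 𝒳, π l ∈ X) ∧
        ∀ X ∈ 𝒳, Adm (Q.filter fun l => π l ∈ X) X) with hD
    set D' : Finset (Finset Λ) := Finset.univ.filter (fun Q : Finset Λ => (∀ l ∈ Q, ∃ X ∈ insert X₀ 𝒳, π l ∈ X) ∧
        ∀ X ∈ insert X₀ 𝒳, Adm (Q.filter fun l => π l ∈ X) X) with hD'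
    rw [Finset.prod_insert hX₀, ih hdisj𝒳, Finset.sum_mul_sum, ← Finset.sum_product']
    -- the bijection `(Q′, Q) ↦ Q′ ∪ Q : S₀ ×ˢ D → D′`
    -- (i) members of `S₀` sit inside `X₀`, members of `D` sit off `X₀`
    have hS₀in : ∀ Q' ∈ S₀, ∀ l ∈ Q', π l ∈ X₀ := fun Q' hQ' =>
      hAdm Q' X₀ (Finset.mem_filter.mp hQ').2
    have hDoff : ∀ Q ∈ D, ∀ l ∈ Q, π l ∉ X₀ := by
      intro Q hQ l hl hl₀
      obtain ⟨X, hX, hlX⟩ := (Finset.mem_filter.mp hQ).2.1 l hl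
      exact Finset.disjoint_left.mp (hd₀ X hX) hl₀ hlX
    have hS₀off : ∀ Q' ∈ S₀, ∀ X ∈ 𝒳, ∀ l ∈ Q', π l ∉ X := fun Q' hQ' X hX l hl hlX =>
      Finset.disjoint_left.mp (hd₀ X hX) (hS₀in Q' hQ' l hl) hlX
    refine Finset.sum_bij' (fun p _ => p.1 ∪ p.2)
      (fun Q'' _ => (Q''.filter (fun l => π l ∈ X₀), Q''.filter (fun l => π l ∉ X₀))) ?_ ?_ ?_ ?_ ?_
    · -- maps into `D′`
      rintro ⟨Q', Q⟩ hp
      obtain ⟨hQ'S, hQD⟩ := Finset.mem_product.mp hp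
      have hQD' := (Finset.mem_filter.mp hQD).2
      refine Finset.mem_filter.mpr ⟨Finset.mem_univ _, ?_, ?_⟩
      · intro l hl
        rcases Finset.mem_union.mp hl with hl | hl
        · exact ⟨X₀, Finset.mem_insert_self _ _, hS₀in Q' hQ'S l hl⟩
        · obtain ⟨X, hX, hlX⟩ := hQD'.1 l hl
          exact ⟨X, Finset.mem_insert_of_mem hX, hlX⟩
      · intro X hX
        rcases Finset.mem_insert.mp hX with rfl | hX
        · rw [filter_union_eq_left π (hS₀in Q' hQ'S) (hDoff Q hQD)]
          exact (Finset.mem_filter.mp hQ'S).2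
        · rw [filter_union_eq_right π (hS₀off Q' hQ'S X hX)]
          exact hQD'.2 X hX
    · -- the inverse maps into `S₀ ×ˢ D`
      intro Q'' hQ''
      obtain ⟨hloc, hadm⟩ := (Finset.mem_filter.mp hQ'').2
      refine Finset.mem_product.mpr ⟨Finset.mem_filter.mpr ⟨Finset.mem_univ _, hadm X₀ (Finset.mem_insert_self _ _)⟩,
        Finset.mem_filter.mpr ⟨Finset.mem_univ _, ?_, ?_⟩⟩
      · intro l hl
        obtain ⟨hl, hl₀⟩ := Finset.mem_filter.mp hl
        obtain ⟨X, hX, hlX⟩ := hloc l hl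
        rcases Finset.mem_insert.mp hX with rfl | hX
        · exact absurd hlX hl₀
        · exact ⟨X, hX, hlX⟩
      · intro X hX
        have hXX : (Q''.filter (fun l => π l ∉ X₀)).filter (fun l => π l ∈ X) = Q''.filter (fun l => π l ∈ X) := by
          ext l
          simp only [Finset.mem_filter]
          exact ⟨fun h => ⟨h.1.1, h.2⟩, fun h => ⟨⟨h.1, fun h₀ => Finset.disjoint_left.mp (hd₀ X hX) h₀ h.2⟩, h.2⟩⟩
        rw [hXX]
        exact hadm X (Finset.mem_insert_of_mem hX)
    · -- left inverse
      rintro ⟨Q', Q⟩ hp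
      obtain ⟨hQ'S, hQD⟩ := Finset.mem_product.mp hp
      refine Prod.ext ?_ ?_
      · exact filter_union_eq_left π (hS₀in Q' hQ'S) (hDoff Q hQD)
      · ext l
        simp only [Finset.mem_filter, Finset.mem_union]
        constructor
        · rintro ⟨hl | hl, hπ⟩
          · exact absurd (hS₀in Q' hQ'S l hl) hπ
          · exact hl
        · exact fun hl => ⟨Or.inr hl, hDoff Q hQD l hl⟩
    · -- right inverse
      intro Q'' _
      exact Finset.filter_union_filter_not_eq _ Q''
    · -- the summands agree
      rintro ⟨Q', Q⟩ hp
      obtain ⟨hQ'S, hQD⟩ := Finset.mem_product.mp hp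
      rw [Finset.prod_insert hX₀, filter_union_eq_left π (hS₀in Q' hQ'S) (hDoff Q hQD)]
      congr 1
      exact Finset.prod_congr rfl (fun X hX => by rw [filter_union_eq_right π (hS₀off Q' hQ'S X hX)])

end OneFamily

/-! ## §2 The hard-core partition function of REAL activities, read as a real sum over compatible families -/

section RealGas

omit [Fintype B] in
open Classical in
/-- Compatible under `polyInc` (incompatible iff equal or overlapping) means pairwise DISJOINT for the members of a finset family.
[cite: FernandezProcacci2007, §2 (hard-core compatibility)] -/
theorem disjoint_of_isCompatible {𝒳 : Finset (Finset B)} (h𝒳 : IsCompatible polyInc 𝒳) :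
    ∀ X ∈ 𝒳, ∀ Y ∈ 𝒳, X ≠ Y → Disjoint X Y := by
  intro X hX Y hY hne
  have h : ¬ polyInc X Y := h𝒳 hX hY hne
  rw [polyInc, not_or, Finset.not_nonempty_iff_eq_empty] at h
  exact Finset.disjoint_iff_inter_eq_empty.mpr h.2

open Classical in
/-- **`Re Ξ` OF REAL ACTIVITIES** over all bond polymers: `Re Ξ_{polyInc}(w) = Σ_{𝒳 ⊆ univ, compatible} Π_{X ∈ 𝒳} w X`.
[cite: FernandezProcacci2007, §2 (2.1); Balaban1989LargeFieldII, (1.90) p.388] -/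
theorem re_polymerPartitionFunction_ofReal (w : Finset B → ℝ) :
    (polymerPartitionFunction polyInc (fun X : Finset B => ((w X : ℝ) : ℂ)) Finset.univ).re =
      ∑ 𝒳 ∈ (Finset.univ : Finset (Finset B)).powerset.filter (fun 𝒳 => IsCompatible polyInc 𝒳), ∏ X ∈ 𝒳, w X := by
  unfold polymerPartitionFunction
  rw [Complex.re_sum, Finset.sum_filter]
  refine Finset.sum_congr rfl (fun 𝒳 _ => ?_)
  split_ifs with h
  · rw [← Complex.ofReal_prod, Complex.ofReal_re]
  · rfl

end RealGas

/-! ## §3 (1.90): the history-indexed, component-factorised sum IS the gas of the footprint-aggregated activities -/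

section Gas

variable (π : Λ → B) (Adm : Finset Λ → Finset B → Prop) (ζ : Finset Λ → Finset B → ℝ)

open Classical in
/-- ★★ **AGGREGATION BY FOOTPRINT, FAMILY-MAJOR FORM** — Bałaban's (1.90): summing the component-factorised contributions over compatible families `𝒳` and over the
histories `Q ∈ Dec 𝒳` they decompose gives EXACTLY the hard-core gas of the aggregated activities `w X := Σ_{Adm Q′ X} ζ Q′ X`.
[cite: Balaban1989LargeFieldII, (1.90)-(1.91) p.388] -/
theorem sum_compatible_sum_dec_eq_re_gasZ (hAdm : ∀ Q' X, Adm Q' X → ∀ l ∈ Q', π l ∈ X) :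
    ∑ 𝒳 ∈ (Finset.univ : Finset (Finset B)).powerset.filter (fun 𝒳 => IsCompatible polyInc 𝒳),
      ∑ Q ∈ Finset.univ.filter (fun Q : Finset Λ => (∀ l ∈ Q, ∃ X ∈ 𝒳, π l ∈ X) ∧ ∀ X ∈ 𝒳, Adm (Q.filter fun l => π l ∈ X) X),
        ∏ X ∈ 𝒳, ζ (Q.filter fun l => π l ∈ X) X =
    (polymerPartitionFunction polyInc
      (fun X : Finset B => (((∑ Q' ∈ Finset.univ.filter (fun Q' : Finset Λ => Adm Q' X), ζ Q' X : ℝ) : ℝ) : ℂ)) Finset.univ).re := by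
  rw [re_polymerPartitionFunction_ofReal]
  refine Finset.sum_congr rfl (fun 𝒳 h𝒳 => ?_)
  rw [prod_sum_eq_sum_dec_prod π Adm ζ hAdm 𝒳 (disjoint_of_isCompatible (Finset.mem_filter.mp h𝒳).2)]

open Classical in
/-- ★ **AGGREGATION BY FOOTPRINT, HISTORY-MAJOR FORM** — the shape the expansion with holes delivers: PER HISTORY `Q` a sum over the compatible families decomposing it;
summed over all histories it is the gas of the aggregated activities. [cite: Balaban1989LargeFieldII, (1.90)-(1.91) p.388; Balaban1985UV3, (41) p.266] -/
theorem sum_hist_sum_dec_eq_re_gasZ (hAdm : ∀ Q' X, Adm Q' X → ∀ l ∈ Q', π l ∈ X) :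
    ∑ Q : Finset Λ, ∑ 𝒳 ∈ (Finset.univ : Finset (Finset B)).powerset.filter (fun 𝒳 => IsCompatible polyInc 𝒳 ∧
        (∀ l ∈ Q, ∃ X ∈ 𝒳, π l ∈ X) ∧ ∀ X ∈ 𝒳, Adm (Q.filter fun l => π l ∈ X) X),
        ∏ X ∈ 𝒳, ζ (Q.filter fun l => π l ∈ X) X =
    (polymerPartitionFunction polyInc
      (fun X : Finset B => (((∑ Q' ∈ Finset.univ.filter (fun Q' : Finset Λ => Adm Q' X), ζ Q' X : ℝ) : ℝ) : ℂ)) Finset.univ).re := by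
  rw [← sum_compatible_sum_dec_eq_re_gasZ π Adm ζ hAdm]
  -- exchange the two finite sums (both sides are the sum over the pairs `(Q, 𝒳)` with `𝒳` compatible and `Q ∈ Dec 𝒳`)
  have hL : ∑ Q : Finset Λ, ∑ 𝒳 ∈ (Finset.univ : Finset (Finset B)).powerset.filter (fun 𝒳 => IsCompatible polyInc 𝒳 ∧
        (∀ l ∈ Q, ∃ X ∈ 𝒳, π l ∈ X) ∧ ∀ X ∈ 𝒳, Adm (Q.filter fun l => π l ∈ X) X),
        ∏ X ∈ 𝒳, ζ (Q.filter fun l => π l ∈ X) X =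
      ∑ Q : Finset Λ, ∑ 𝒳 ∈ (Finset.univ : Finset (Finset B)).powerset.filter (fun 𝒳 => IsCompatible polyInc 𝒳),
        if (∀ l ∈ Q, ∃ X ∈ 𝒳, π l ∈ X) ∧ ∀ X ∈ 𝒳, Adm (Q.filter fun l => π l ∈ X) X
        then ∏ X ∈ 𝒳, ζ (Q.filter fun l => π l ∈ X) X else 0 := by
    refine Finset.sum_congr rfl (fun Q _ => ?_)
    rw [← Finset.sum_filter, Finset.filter_filter]
  have hR : ∑ 𝒳 ∈ (Finset.univ : Finset (Finset B)).powerset.filter (fun 𝒳 => IsCompatible polyInc 𝒳),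
      ∑ Q ∈ Finset.univ.filter (fun Q : Finset Λ => (∀ l ∈ Q, ∃ X ∈ 𝒳, π l ∈ X) ∧ ∀ X ∈ 𝒳, Adm (Q.filter fun l => π l ∈ X) X),
        ∏ X ∈ 𝒳, ζ (Q.filter fun l => π l ∈ X) X =
      ∑ 𝒳 ∈ (Finset.univ : Finset (Finset B)).powerset.filter (fun 𝒳 => IsCompatible polyInc 𝒳), ∑ Q : Finset Λ,
        if (∀ l ∈ Q, ∃ X ∈ 𝒳, π l ∈ X) ∧ ∀ X ∈ 𝒳, Adm (Q.filter fun l => π l ∈ X) X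
        then ∏ X ∈ 𝒳, ζ (Q.filter fun l => π l ∈ X) X else 0 := by
    refine Finset.sum_congr rfl (fun 𝒳 _ => ?_)
    rw [← Finset.sum_filter]
  rw [hL, hR, Finset.sum_comm]

open Classical in
/-- ★ **THE SOCKET (R1∘-gas) PLUGS INTO**: if every history's contribution `r Q` (at a fixed window field: the ratio of the canonical `histEvent Q` density to the
all-small one) IS its component-factorised expansion `Σ_{𝒳 compatible, Q ∈ Dec 𝒳} Π_{X∈𝒳} ζ (Q↾X) X`, then the history sum `Σ_Q r Q` is the hard-core gas of the
footprint-aggregated activities — the `Re Ξ_{polyInc}(w_U)` of LFG^{can}∘ (with `r ∅ = 1` the empty family's term). [cite: Balaban1989LargeFieldII, (1.90)-(1.91) p.388; Balaban1985UV3, (41) p.266] -/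
theorem sum_ratios_eq_re_gasZ (hAdm : ∀ Q' X, Adm Q' X → ∀ l ∈ Q', π l ∈ X) (r : Finset Λ → ℝ)
    (hr : ∀ Q : Finset Λ, r Q = ∑ 𝒳 ∈ (Finset.univ : Finset (Finset B)).powerset.filter (fun 𝒳 => IsCompatible polyInc 𝒳 ∧
        (∀ l ∈ Q, ∃ X ∈ 𝒳, π l ∈ X) ∧ ∀ X ∈ 𝒳, Adm (Q.filter fun l => π l ∈ X) X),
        ∏ X ∈ 𝒳, ζ (Q.filter fun l => π l ∈ X) X) :
    ∑ Q : Finset Λ, r Q =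
    (polymerPartitionFunction polyInc
      (fun X : Finset B => (((∑ Q' ∈ Finset.univ.filter (fun Q' : Finset Λ => Adm Q' X), ζ Q' X : ℝ) : ℝ) : ℂ)) Finset.univ).re := by
  rw [← sum_hist_sum_dec_eq_re_gasZ π Adm ζ hAdm]
  exact Finset.sum_congr rfl (fun Q _ => hr Q)

end Gas

/-! ## §4 The letters the aggregate inherits: V-locality, the majorant, vanishing on `∅`, and the ENERGY TRANSFER from per-plaquette small factors -/

section Letters

variable {G : Type*} (π : Λ → B) (Adm : Finset Λ → Finset B → Prop)

omit [Fintype B] [DecidableEq B] [DecidableEq Λ] in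
open Classical in
/-- **V-LOCALITY IS INHERITED**: if every admissible component activity `ζ Q′ X ·` depends on the field only through the bonds of `X`, so does the aggregate
`w U X = Σ_{Adm Q′ X} ζ Q′ X U`. [cite: Balaban1989LargeFieldII, (1.99) p.390 («depends on U_k restricted to X»)] -/
theorem aggregate_local (ζ : Finset Λ → Finset B → (B → G) → ℝ)
    (hloc : ∀ Q' X (U U' : B → G), Adm Q' X → (∀ e ∈ X, U e = U' e) → ζ Q' X U = ζ Q' X U')
    (X : Finset B) (U U' : B → G) (hUU' : ∀ e ∈ X, U e = U' e) :
    ∑ Q' ∈ Finset.univ.filter (fun Q' : Finset Λ => Adm Q' X), ζ Q' X U =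
      ∑ Q' ∈ Finset.univ.filter (fun Q' : Finset Λ => Adm Q' X), ζ Q' X U' :=
  Finset.sum_congr rfl (fun Q' hQ' => hloc Q' X U U' (Finset.mem_filter.mp hQ').2 hUU')

omit [Fintype B] [DecidableEq B] [DecidableEq Λ] in
open Classical in
/-- **THE MAJORANT IS INHERITED**: `|w U X| ≤ w̄ X := Σ_{Adm Q′ X} ζ̄ Q′ X` whenever `|ζ Q′ X U| ≤ ζ̄ Q′ X` on the window.
[cite: Balaban1989LargeFieldII, (1.92) p.388 and (1.97) p.389] -/
theorem abs_aggregate_le (ζ : Finset Λ → Finset B → (B → G) → ℝ) (ζbar : Finset Λ → Finset B → ℝ) (W : Set (B → G))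
    (hdom : ∀ Q' X U, Adm Q' X → U ∈ W → |ζ Q' X U| ≤ ζbar Q' X) (X : Finset B) (U : B → G) (hU : U ∈ W) :
    |∑ Q' ∈ Finset.univ.filter (fun Q' : Finset Λ => Adm Q' X), ζ Q' X U| ≤
      ∑ Q' ∈ Finset.univ.filter (fun Q' : Finset Λ => Adm Q' X), ζbar Q' X :=
  (Finset.abs_sum_le_sum_abs _ _).trans (Finset.sum_le_sum fun Q' hQ' => hdom Q' X U (Finset.mem_filter.mp hQ').2 hU)

omit [Fintype B] [DecidableEq B] [DecidableEq Λ] in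
open Classical in
/-- **NOTHING AGGREGATES ON THE EMPTY POLYMER**: if no sub-history is admissible for `∅` (admissible components carry at least one large plaquette, located inside the
component), then `w U ∅ = 0`. [cite: Balaban1989LargeFieldII, (1.98) p.390 («admissible domains … contain at least one large field region»)] -/
theorem aggregate_empty {β : Type*} [AddCommMonoid β] (f : Finset Λ → β) (hAdmE : ∀ Q', ¬ Adm Q' ∅) :
    ∑ Q' ∈ Finset.univ.filter (fun Q' : Finset Λ => Adm Q' ∅), f Q' = 0 := by
  rw [Finset.filter_false_of_mem (fun Q' _ => hAdmE Q'), Finset.sum_empty]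

omit [Fintype Λ] [DecidableEq Λ] in
/-- `Π_{l ∈ S} (1 + sf l) ≤ e^{Σ_{l ∈ S} sf l}` for `sf ≥ 0`. [cite: Balaban1985UV3, (67)-(71) p.273 (bookkeeping)] -/
theorem prod_one_add_le_exp_sum (sf : Λ → ℝ) (hsf : ∀ l, 0 ≤ sf l) (S : Finset Λ) :
    ∏ l ∈ S, (1 + sf l) ≤ Real.exp (∑ l ∈ S, sf l) := by
  rw [Real.exp_sum]
  exact Finset.prod_le_prod (fun l _ => by linarith [hsf l]) (fun l _ => by linarith [Real.add_one_le_exp (sf l)])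

omit [Fintype B] in
open Classical in
/-- ★ **ENERGY TRANSFER — per-plaquette small factors ⇒ the footprint majorant of FILE 1.**  If admissible sub-histories are NONEMPTY and located inside their component, and
the component majorants carry the product of per-plaquette small factors `sf ≥ 0` times a footprint factor `E X ≥ 0` (`ζ̄ Q′ X ≤ (Π_{l∈Q′} sf l)·E X`), then the aggregated
majorant obeys `w̄ X ≤ (e^{σ_X} − 1)·E X ≤ σ_X·e^{σ_X}·E X` with `σ_X := Σ_{l : π l ∈ X} sf l` — the resummation `Σ_{∅ ≠ Q′ ⊆ π⁻¹X} Π sf = Π(1 + sf) − 1` of the history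
partition ((41); ✓`…HistoryPartition.sum_prod_smallFactor_eq` is the whole-lattice instance). [cite: Balaban1985UV3, (41) p.266 and (67)-(71) pp.273-274; Balaban1989LargeFieldII, (1.92)-(1.97) pp.388-389] -/
theorem aggregate_majorant_le (ζbar : Finset Λ → Finset B → ℝ) (sf : Λ → ℝ) (E : Finset B → ℝ)
    (hsf : ∀ l, 0 ≤ sf l) (hE : ∀ X, 0 ≤ E X)
    (hAdm : ∀ Q' X, Adm Q' X → Q'.Nonempty ∧ ∀ l ∈ Q', π l ∈ X)
    (hζ : ∀ Q' X, Adm Q' X → ζbar Q' X ≤ (∏ l ∈ Q', sf l) * E X) (X : Finset B) :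
    ∑ Q' ∈ Finset.univ.filter (fun Q' : Finset Λ => Adm Q' X), ζbar Q' X ≤
      (∑ l ∈ Finset.univ.filter (fun l => π l ∈ X), sf l) *
        Real.exp (∑ l ∈ Finset.univ.filter (fun l => π l ∈ X), sf l) * E X := by
  set S : Finset Λ := Finset.univ.filter (fun l => π l ∈ X) with hS
  -- admissible sub-histories are nonempty subsets of `S`
  have hsub : Finset.univ.filter (fun Q' : Finset Λ => Adm Q' X) ⊆ S.powerset.erase ∅ := by
    intro Q' hQ'
    obtain ⟨hne, hin⟩ := hAdm Q' X (Finset.mem_filter.mp hQ').2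
    refine Finset.mem_erase.mpr ⟨hne.ne_empty, Finset.mem_powerset.mpr fun l hl => ?_⟩
    exact Finset.mem_filter.mpr ⟨Finset.mem_univ _, hin l hl⟩
  have hprod0 : ∀ Q' : Finset Λ, 0 ≤ (∏ l ∈ Q', sf l) * E X := fun Q' => mul_nonneg (Finset.prod_nonneg fun l _ => hsf l) (hE X)
  calc ∑ Q' ∈ Finset.univ.filter (fun Q' : Finset Λ => Adm Q' X), ζbar Q' X
      ≤ ∑ Q' ∈ Finset.univ.filter (fun Q' : Finset Λ => Adm Q' X), (∏ l ∈ Q', sf l) * E X :=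
        Finset.sum_le_sum fun Q' hQ' => hζ Q' X (Finset.mem_filter.mp hQ').2
    _ ≤ ∑ Q' ∈ S.powerset.erase ∅, (∏ l ∈ Q', sf l) * E X := Finset.sum_le_sum_of_subset_of_nonneg hsub (fun Q' _ _ => hprod0 Q')
    _ = (∑ Q' ∈ S.powerset, (∏ l ∈ Q', sf l)) * E X - E X := by
        rw [← Finset.sum_mul, ← Finset.sum_erase_add _ _ (Finset.empty_mem_powerset S), Finset.prod_empty, add_mul, one_mul]
        ring
    _ = ((∏ l ∈ S, (1 + sf l)) - 1) * E X := by rw [Finset.prod_one_add]; ring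
    _ ≤ (Real.exp (∑ l ∈ S, sf l) - 1) * E X := by
        refine mul_le_mul_of_nonneg_right ?_ (hE X)
        linarith [prod_one_add_le_exp_sum sf hsf S]
    _ ≤ (∑ l ∈ S, sf l) * Real.exp (∑ l ∈ S, sf l) * E X :=
        mul_le_mul_of_nonneg_right (Literature.MathematicalPhysics.QuantumFieldTheory.AreaLaw.exp_sub_one_le_mul_exp _) (hE X)

end Letters

end Summit.QuantumFields.YangMills.Theorems.FluctuationComparisonRegPrIntLLargeFieldGasAggregation

end
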